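import Summits.BirchSwinnertonDyer.BirchSwinnertonDyer.Theorems.GenusKolyvaginAtTwoPowDvdShaCardAtTwoRTBottomRungEngineDeep
import HarnessLib

/-!
# Route `GenusKolyvaginAtTwo`, crux L_T `PowDvdShaCardAtTwoRT` (stmt-BirchSwinnertonDyer-23242), LINE 18 stub KS, bottom rung:
# THE DEEP-PRIME ENGINE, ROBUST FORM — non-phantom hypothesis at the places over `2N`

LEAD seat `bsd-line-gk2-p1` g17 (cell `bsd-f1-sign2`), `--supports 23242 --as helper`.  THEOREMS ONLY; no `sorry`; standard axioms.
BSD is NOT proved by any of this; neither is the crux, nor stub KS, nor stub L.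

WHY.  `false_of_bottomRung_engine_deep` (this seat, `…RTBottomRungEngineDeep`) displays the non-phantom hypothesis in the form «phantom at level
`2^L` ∧ Selmer at the places over `N` ⟹ 0».  A phantom class (inflated from `K(E[2^L])/K`, unramified outside `2N∞`) can be ramified at the
places over `2` even when `2 ∤ N`, so the HONEST statement of the non-phantom input — the one registered as stub NPh of the LINE 18 skeleton
v5.2 and the one gk2-p3 g22 proves from one odd multiplicative place — asks the Selmer condition at the places over `2N`.  This file is that
variant; the Kolyvagin class `c₂(n)` and the restricted auxiliary class are Selmer at the places over `2N` as well (Kolyvagin primes are odd and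
prime to `N`).
* `inr_under_notMem_of_two_mul_conductorNorm_mem` — a place of `K` over `2N` is not over a Zhang–Kolyvagin prime;
* **`false_of_bottomRung_engine_deep'`** — the deep-prime engine with (NPh_L^{2N}).
Namespace `…Theorems.GenusExact.RelaxedCount`.  Closes nothing.  BSD is NOT proved by any of this.

References: [McCallumLMS1991] §3 Cor. 3.2, §4 (5), §5 proof of Prop. 5.2; [GrossLMS1991] §3 (3.1), (3.3), Prop. 6.2, §9.
-/

set_option autoImplicit false
-- the Theorems namespace of this sub repeats the summit name by design (D-0017 nested layout)
set_option linter.dupNamespace false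

noncomputable section

open scoped Classical

open Field NumberField IsDedekindDomain Function WeierstrassCurve Rat.HeightOneSpectrum
open Literature.NumberTheory.EllipticCurves
open Literature.NumberTheory.GaloisRepresentations
open Literature.NumberTheory.GaloisCohomology
open Summit.BirchSwinnertonDyer.Rank1Residual.X11b.Relaxation
open Summit.BirchSwinnertonDyer.BirchSwinnertonDyer.Theorems.GenusExact.SelmerDescent
open Summit.BirchSwinnertonDyer.BirchSwinnertonDyer.Theorems.GenusExact.VisiblePairAtTwo
  (natCast_mem_primesEquiv_symm natGenerator_eq_of_natCast_prime_mem liesOver_of_natCast_mem natCast_mem_of_liesOver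
    exists_natCast_mem intCast_notMem_of_not_dvd torsionH1OfDvd_mem_torsionLocalKer)
open Summit.BirchSwinnertonDyer.BirchSwinnertonDyer.Theorems.KolyvaginRatDescentTwo (resTorsion_mem_selmerLocalKer_of_under)

namespace Summit.BirchSwinnertonDyer.BirchSwinnertonDyer.Theorems.GenusExact.RelaxedCount

variable (W : WeierstrassCurve ℚ) [W.IsElliptic] [W.IsGloballyMinimal]

/-! ## §4 The same with the non-phantom hypothesis at the places over `2N` (the robust form) -/

omit [W.IsElliptic] in
/-- **A place of `K` dividing `2N` is not over a Zhang–Kolyvagin prime** (`ℓ ≠ 2`, `ℓ ∤ N`): for `w` with `(2N : 𝓞 K) ∈ w` and `T` a finite set of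
places of `ℚ` each under a Zhang–Kolyvagin prime, `inr (w ∩ ℚ) ∉ T`. [cite: GrossLMS1991, §3 (3.1)] -/
theorem inr_under_notMem_of_two_mul_conductorNorm_mem {K : Type} [Field K] [NumberField K] (T : Finset (Place ℚ))
    (hT : ∀ u ∈ T, ∃ (v : HeightOneSpectrum (𝓞 ℚ)) (ℓ : ℕ), u = Sum.inr v ∧ ℓ.Prime ∧ (ℓ : 𝓞 ℚ) ∈ v.asIdeal ∧
      Zhang2014.IsKolyvaginPrime (W.conductorNorm ℤ) W K 2 ℓ)
    (w : HeightOneSpectrum (𝓞 K)) (hw : ((2 * W.conductorNorm ℤ : ℕ) : 𝓞 K) ∈ w.asIdeal) :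
    (Sum.inr (w.under (𝓞 ℚ)) : Place ℚ) ∉ T := by
  intro hmem
  obtain ⟨v, ℓ, huv, hℓp, hℓv, hKol⟩ := hT _ hmem
  have hvw : w.under (𝓞 ℚ) = v := Sum.inr_injective huv
  have hNv : ((2 * W.conductorNorm ℤ : ℕ) : 𝓞 ℚ) ∈ v.asIdeal := by
    rw [← hvw]
    change ((2 * W.conductorNorm ℤ : ℕ) : 𝓞 ℚ) ∈ w.asIdeal.under (𝓞 ℚ)
    rw [Ideal.under_def, Ideal.mem_comap, map_natCast]
    exact hw
  have hdvd := (Rat.natCast_mem_asIdeal_iff v).mp hNv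
  rw [natGenerator_eq_of_natCast_prime_mem hℓp hℓv] at hdvd
  rcases (Nat.Prime.dvd_mul hℓp).mp hdvd with h2 | hN
  · exact hKol.2.2.2.1 ((Nat.prime_dvd_prime_iff_eq hℓp Nat.prime_two).mp h2)
  · exact hKol.2.1 hN


/-- **The one-step engine of the bottom rung, DEEP Čebotarev prime chosen INSIDE — robust form (NPh at the places over `2N`).**  Same as
`false_of_bottomRung_engine_deep` with the non-phantom hypothesis asking the Selmer condition at the places of `K` over `2N` (where a phantom class
can be ramified) instead of over `N` only; this is the form registered as stub NPh of the LINE 18 skeleton v5.2.  Frame as `false_of_bottomRung_engine_cheb` (g17, p708250), plus a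
target depth `L ≥ 2`.  Displayed: `cK = c₂(n)` (order `4`, `conjAct σ cK = ±cK`, Selmer at the finite places not over `s ∪ t` and at those over
`N`); **(NPh_L^N)** «no non-zero class of `H¹(K, E[2^L])` dying on `Γ_{K(E[2^L])}` is Selmer at every place over `N`»; and `hstep`: for every
auxiliary `y` (Kummer off `s ∪ t`, `2y ≠ 0`) a finite exceptional set `S₀`, and for every Zhang–Kolyvagin `ℓ′ ∉ S₀` of index `≥ L` with
`Frob = Frob_∞` on `K(E[2^L])` (so DEEP), outside `s ∪ t`, at whose inert place `w′` both `cK` and `res_K y` have local order exactly `4`, the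
bookkeeping (desc)/(Kum)/(Q2@w′)/(free)+(M)/(tr) of g16's engine.  THEN `False`.  Proof: `ι cK`, `ι res_K y ∈ H¹(K, E[2^L])` have order `4`
(McCallum (5): `ι` injective as `E(K)[2] = 0`) and signs `±1`, `+1`; their span meets no phantom by (NPh_L^N) (both Selmer over `N`); the
full-order pair Čebotarev at level `2^L` gives infinitely many deep `ℓ′`; the level-`2^L` order clauses descend to level `4`; g16's
`false_of_bottomRung_engine` concludes. [cite: McCallumLMS1991, §3 Cor. 3.2; §4 (5); §5 proof of Prop. 5.2] [cite: GrossLMS1991, Prop. 6.2 and §9] -/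
theorem false_of_bottomRung_engine_deep' [NeZero (W.conductorNorm ℤ)] (hcm : ¬ W.HasCM) (hΔ : W.Δ < 0)
    (hρ : ∀ n : ℕ, W.HasSurjectiveModNGaloisRep (2 ^ n : ℕ))
    {K : Type} [Field K] [NumberField K] (hK : IsImaginaryQuadratic K)
    (hns : ¬ IsSquare ((NumberField.discr K : ℚ) * -|W.Δ|))
    {θ : K} (hθ : θ ∉ (algebraMap ℚ K).range) {c : ℤ} (hc : θ ^ 2 = algebraMap ℚ K c)
    (σ : K ≃ₐ[ℚ] K) (hσ : σ ≠ 1) {L : ℕ} (hL2 : 2 ≤ L)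
    (s t : Finset (Place ℚ)) (hst : Disjoint s t) (hs : s.Nonempty)
    (hTK : ∀ u ∈ s ∪ t, ∃ (v : HeightOneSpectrum (𝓞 ℚ)) (ℓ : ℕ) (_ : Fact ℓ.Prime), u = Sum.inr v ∧ ℓ ≠ 2 ∧ (ℓ : 𝓞 ℚ) ∈ v.asIdeal ∧
      W.HasGoodReductionAtPrime ℓ ∧ FrobEqFrobInfty W K 2 ℓ ∧ 2 ≤ Zhang2014.kolyvaginIndex W 2 ℓ ∧
      Zhang2014.IsKolyvaginPrime (W.conductorNorm ℤ) W K 2 ℓ)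
    (ht4 : ∀ (v : HeightOneSpectrum (𝓞 ℚ)) (ℓ : ℕ), ℓ.Prime → Sum.inr v ∈ t → (ℓ : 𝓞 ℚ) ∈ v.asIdeal →
      FrobEqFrobInfty W K (2 ^ 2) ℓ)
    -- the Kolyvagin class `c₂(n)`: order `4`, eigen, Selmer off `s ∪ t` and over `N`
    (cK : galH1Torsion (W.baseChange K) ((2 ^ 2 : ℕ) : ℤ)) (hcK4 : addOrderOf cK = 2 ^ 2)
    {sK : ℤ} (hsK : sK = 1 ∨ sK = -1) (hτcK : conjAct W σ ((2 ^ 2 : ℕ) : ℤ) cK = sK • cK)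
    (hcKsel : ∀ w : HeightOneSpectrum (𝓞 K), (Sum.inr (w.under (𝓞 ℚ)) : Place ℚ) ∉ s ∪ t →
      cK ∈ selmerLocalKer (W.baseChange K) (w.adicCompletion K) ((2 ^ 2 : ℕ) : ℤ))
    -- (NPh_L^{2N}): no non-zero phantom class at level `2^L` is Selmer at the places over `2N`
    (hNPh : ∀ z : galH1Torsion (W.baseChange K) ((2 ^ L : ℕ) : ℤ),
      (∀ ρ ∈ torsionFixing (W.baseChange K) ((2 ^ L : ℕ) : ℤ), h1Eval (W.baseChange K) ((2 ^ L : ℕ) : ℤ) z ρ = 0) →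
      (∀ w : HeightOneSpectrum (𝓞 K), ((2 * W.conductorNorm ℤ : ℕ) : 𝓞 K) ∈ w.asIdeal →
        z ∈ selmerLocalKer (W.baseChange K) (w.adicCompletion K) ((2 ^ L : ℕ) : ℤ)) → z = 0)
    -- the `K`-side bookkeeping at the new DEEP prime, as a function of `ℓ′`
    (hstep : ∀ y ∈ kummerOutside W (2 ^ 2) (s ∪ t), 2 • y ≠ 0 → ∃ S₀ : Finset ℕ,
      ∀ (ℓ' : ℕ) (v' : HeightOneSpectrum (𝓞 ℚ)) (w' : HeightOneSpectrum (𝓞 K)), w'.asIdeal.LiesOver v'.asIdeal →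
        ℓ' ∉ S₀ → ℓ'.Prime → (ℓ' : 𝓞 ℚ) ∈ v'.asIdeal → (ℓ' : 𝓞 K) ∈ w'.asIdeal →
        Zhang2014.IsKolyvaginPrime (W.conductorNorm ℤ) W K 2 ℓ' → FrobEqFrobInfty W K (2 ^ L) ℓ' →
        L ≤ Zhang2014.kolyvaginIndex W 2 ℓ' → (Sum.inr v' : Place ℚ) ∉ s ∪ t →
        (∀ j : ℕ, ((2 ^ j : ℕ) : ℤ) • cK ∈ (W.baseChange K).torsionLocalKer (w'.adicCompletion K) ((2 ^ 2 : ℕ) : ℤ) ↔ 2 ≤ j) →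
        (∀ j : ℕ, ((2 ^ j : ℕ) : ℤ) • resTorsion W K ((2 ^ 2 : ℕ) : ℤ) y ∈
          (W.baseChange K).torsionLocalKer (w'.adicCompletion K) ((2 ^ 2 : ℕ) : ℤ) ↔ 2 ≤ j) →
        ∃ (Z : galoisCohomology (W.torsionGaloisModule ((2 ^ 2 : ℕ) : ℤ)) 1)
          (cK' : galH1Torsion (W.baseChange K) ((2 ^ 2 : ℕ) : ℤ)),
          resTorsion W K ((2 ^ 2 : ℕ) : ℤ) Z = cK' ∧
          (∀ v : HeightOneSpectrum (𝓞 ℚ), (Sum.inr v : Place ℚ) ∉ insert (Sum.inr v' : Place ℚ) (s ∪ t) →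
            ∀ w : HeightOneSpectrum (𝓞 K), w.asIdeal.LiesOver v.asIdeal →
              cK' ∈ selmerLocalKer (W.baseChange K) (w.adicCompletion K) ((2 ^ 2 : ℕ) : ℤ)) ∧
          (∀ j : ℕ,
            (((2 ^ j : ℕ) : ℤ) • cK' ∈ selmerLocalKer (W.baseChange K) (w'.adicCompletion K) ((2 ^ 2 : ℕ) : ℤ) ↔
              ((2 ^ j : ℕ) : ℤ) • cK' ∈ (W.baseChange K).torsionLocalKer (w'.adicCompletion K) ((2 ^ 2 : ℕ) : ℤ)) ∧
            (((2 ^ j : ℕ) : ℤ) • cK' ∈ (W.baseChange K).torsionLocalKer (w'.adicCompletion K) ((2 ^ 2 : ℕ) : ℤ) ↔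
              ((2 ^ j : ℕ) : ℤ) • cK ∈ (W.baseChange K).torsionLocalKer (w'.adicCompletion K) ((2 ^ 2 : ℕ) : ℤ))) ∧
          (∀ u ∈ s, ∃ (v : HeightOneSpectrum (𝓞 ℚ)) (ℓ : ℕ) (w : HeightOneSpectrum (𝓞 K)) (_ : w.asIdeal.LiesOver v.asIdeal)
            (cKu : galH1Torsion (W.baseChange K) ((2 ^ 2 : ℕ) : ℤ)),
            u = Sum.inr v ∧ ℓ.Prime ∧ (ℓ : 𝓞 ℚ) ∈ v.asIdeal ∧ ((c : ℤ) : 𝓞 ℚ) ∉ v.asIdeal ∧ FrobEqFrobInfty W K (2 ^ 2) ℓ ∧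
            w.asIdeal.inertiaDeg (𝓞 ℚ) = 2 ∧
            (((2 ^ 1 : ℕ) : ℤ) • cK' ∈ (W.baseChange K).torsionLocalKer (w.adicCompletion K) ((2 ^ 2 : ℕ) : ℤ) ↔
              ((2 ^ 1 : ℕ) : ℤ) • cKu ∈ (W.baseChange K).torsionLocalKer (w.adicCompletion K) ((2 ^ 2 : ℕ) : ℤ)) ∧
            (2 : ℤ) • cKu = 0) ∧
          (∀ v : HeightOneSpectrum (𝓞 ℚ), Sum.inr v ∈ t →
            ∀ 𝔓 ∈ v.primesAbove, ∀ F c₀ : absoluteGaloisGroup ℚ, IsArithFrobAt (𝓞 ℚ) F 𝔓 →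
              IsComplexConjugation (Rat.castHom ℝ) c₀ → (∀ P : geomTorsion W ((2 ^ 2 : ℕ) : ℤ), F • P = c₀ • P) →
              ∃ P₁ : geomTorsion W ((2 ^ 2 : ℕ) : ℤ), h1Eval W _ ((2 : ℕ) • Z) F = F • P₁ - P₁)) :
    False := by
  haveI : Fact (Nat.Prime 2) := ⟨Nat.prime_two⟩
  have h2K : Module.finrank ℚ K = 2 := hK.1
  haveI : IsGalois ℚ K := isGalois_of_finrank_eq_two K h2K
  have hρ2 : W.HasSurjectiveModNGaloisRep 2 := by simpa using hρ 1
  have hL1 : 1 ≤ L := by omega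
  have h4L : ((2 ^ 2 : ℕ) : ℤ) ∣ ((2 ^ L : ℕ) : ℤ) := by
    obtain ⟨e, he⟩ := Nat.exists_eq_add_of_le hL2
    exact ⟨((2 ^ e : ℕ) : ℤ), by rw [he, pow_add]; push_cast; ring⟩
  -- `θ ∉ ℚ` in the `Set.range` form, and `c ≠ 0`
  have hθ' : θ ∉ Set.range (algebraMap ℚ K) := fun ⟨q, hq⟩ ↦ hθ ⟨q, hq⟩
  have hc0 : c ≠ 0 := by
    rintro rfl
    apply hθ
    refine ⟨0, ?_⟩
    have h0 : θ ^ 2 = 0 := by rw [hc]; simp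
    rw [map_zero]
    exact (pow_eq_zero_iff two_ne_zero).mp h0 |>.symm
  -- injectivities: `res_K` at level `4`, and the change of level `ι : H¹(K, E[4]) → H¹(K, E[2^L])`
  have hinj : Injective (resTorsion W K ((2 ^ 2 : ℕ) : ℤ)) :=
    (EigenClassesFinite.eigen_description_two_pow_of_hasSurjectiveModNGaloisRep_two W K h2K hθ'
      (c := (c : ℚ)) (by exact_mod_cast hc) hρ2 2).1
  have hbotK : AddSubgroup.torsionBy (W.baseChange K).toAffine.Point ((2 : ℕ) : ℤ) = ⊥ := by
    rw [eq_bot_iff]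
    intro P hP
    rw [AddSubgroup.mem_bot]
    have hP' : 2 • P = 0 := by
      have h := (mem_torsionBy_iff.mp hP : ((2 : ℕ) : ℤ) • P = 0)
      rwa [natCast_zsmul] at h
    exact forall_two_nsmul_baseChange_of_hasSurjectiveModNGaloisRep_two_of_isImaginaryQuadratic W hρ2 K hK P hP'
  have hιinj : Injective (torsionH1OfDvd (W.baseChange K) h4L) :=
    Summit.BirchSwinnertonDyer.BirchSwinnertonDyer.Theorems.GenusExact.VisiblePairAtTwo.torsionH1OfDvd_pow_injective
      (W.baseChange K) (p := 2) hbotK h4L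
  set ι := torsionH1OfDvd (W.baseChange K) h4L with hι_def
  -- the frame data of `s ∪ t` in the two currencies
  have hTK₀ : ∀ u ∈ s ∪ t, ∃ (v : HeightOneSpectrum (𝓞 ℚ)) (ℓ : ℕ) (_ : Fact ℓ.Prime), u = Sum.inr v ∧ ℓ ≠ 2 ∧
      (ℓ : 𝓞 ℚ) ∈ v.asIdeal ∧ W.HasGoodReductionAtPrime ℓ ∧ FrobEqFrobInfty W K 2 ℓ ∧ 2 ≤ Zhang2014.kolyvaginIndex W 2 ℓ := by
    intro u hu
    obtain ⟨v, ℓ, hℓp, huv, hℓ2, hℓv, hgood, hFrob, hidx, -⟩ := hTK u hu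
    exact ⟨v, ℓ, hℓp, huv, hℓ2, hℓv, hgood, hFrob, hidx⟩
  have hTN : ∀ u ∈ s ∪ t, ∃ (v : HeightOneSpectrum (𝓞 ℚ)) (ℓ : ℕ), u = Sum.inr v ∧ ℓ.Prime ∧ (ℓ : 𝓞 ℚ) ∈ v.asIdeal ∧
      Zhang2014.IsKolyvaginPrime (W.conductorNorm ℤ) W K 2 ℓ := by
    intro u hu
    obtain ⟨v, ℓ, hℓp, huv, -, hℓv, -, -, -, hKol⟩ := hTK u hu
    exact ⟨v, ℓ, huv, hℓp.out, hℓv, hKol⟩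
  refine false_of_bottomRung_engine W hΔ hρ2 hK hθ hc s t hst hs hTK₀ ht4 fun y hyKO hy2 ↦ ?_
  -- ### the level-raised classes `X = ι cK`, `Y = ι (res_K y)`: order `4`, eigen
  set yK := resTorsion W K ((2 ^ 2 : ℕ) : ℤ) y with hyK_def
  set X := ι cK with hX_def
  set Y := ι yK with hY_def
  have hyK2 : ¬ 2 ^ 1 • yK = 0 := by
    intro h
    apply hy2
    have h2 : resTorsion W K ((2 ^ 2 : ℕ) : ℤ) (2 • y) = 0 := by
      refine (map_nsmul (resTorsion W K ((2 ^ 2 : ℕ) : ℤ)) 2 y).trans ?_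
      rw [pow_one] at h
      exact h
    exact (injective_iff_map_eq_zero _).mp hinj _ h2
  have hyK4 : 2 ^ (1 + 1) • yK = 0 := by
    have h : (((2 ^ 2 : ℕ) : ℤ)) • yK = 0 := zsmul_discreteH1_torsion _ yK
    rw [natCast_zsmul] at h
    exact h
  have hyKord : addOrderOf yK = 2 ^ 2 := addOrderOf_eq_prime_pow hyK2 hyK4
  have hXord : addOrderOf X = 2 ^ 2 := by rw [hX_def, addOrderOf_injective ι hιinj, hcK4]
  have hYord : addOrderOf Y = 2 ^ 2 := by rw [hY_def, addOrderOf_injective ι hιinj, hyKord]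
  have hτX : conjAct W σ ((2 ^ L : ℕ) : ℤ) X = sK • X := by
    rw [hX_def, hι_def, conjAct_torsionH1OfDvd, hτcK, map_zsmul]
  have hτY : conjAct W σ ((2 ^ L : ℕ) : ℤ) Y = (1 : ℤ) • Y := by
    rw [one_zsmul, hY_def, hι_def, conjAct_torsionH1OfDvd, hyK_def, conjAct_resTorsion K W _ σ h2K hσ y]
  -- ### Selmer conditions of `cK`, `yK` at the places over `N`
  have hySel : ∀ w : HeightOneSpectrum (𝓞 K), (Sum.inr (w.under (𝓞 ℚ)) : Place ℚ) ∉ s ∪ t →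
      yK ∈ selmerLocalKer (W.baseChange K) (w.adicCompletion K) ((2 ^ 2 : ℕ) : ℤ) := by
    intro w hw
    have hyv : y ∈ selmerLocalKer W ((w.under (𝓞 ℚ)).adicCompletion ℚ) ((2 ^ 2 : ℕ) : ℤ) :=
      (res_mem_kummerLocalConditionAt_iff W ((2 ^ 2 : ℕ) : ℤ) (Place.Completion (Sum.inr (w.under (𝓞 ℚ)) : Place ℚ)) y).mp
        ((mem_kummerOutside_iff W (2 ^ 2) (s ∪ t) y).mp hyKO _ hw)
    exact resTorsion_mem_selmerLocalKer_of_under K W _ w hyv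
  -- ### Q5R's separation hypothesis at level `2^L`, from (NPh_L^N)
  have hres : ∀ a b : ℤ, (∀ ρ' ∈ torsionFixing (W.baseChange K) ((2 ^ L : ℕ) : ℤ),
      h1Eval (W.baseChange K) ((2 ^ L : ℕ) : ℤ) (a • X + b • Y) ρ' = 0) → a • X + b • Y = 0 := by
    intro a b hab
    refine hNPh _ hab fun w hw ↦ ?_
    have hw' := inr_under_notMem_of_two_mul_conductorNorm_mem W (s ∪ t) hTN w hw
    refine add_mem (AddSubgroup.zsmul_mem _ ?_ a) (AddSubgroup.zsmul_mem _ ?_ b)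
    · exact (torsionH1OfDvd_mem_selmerLocalKer_iff_mem (W.baseChange K) h4L (w.adicCompletion K) cK).mpr (hcKsel w hw')
    · exact (torsionH1OfDvd_mem_selmerLocalKer_iff_mem (W.baseChange K) h4L (w.adicCompletion K) yK).mpr (hySel w hw')
  -- ### the exceptional set and the DEEP Čebotarev prime
  obtain ⟨S₀, hS₀⟩ := hstep y hyKO hy2
  set Sst : Finset ℕ := ((s ∪ t).preimage Sum.inr Sum.inr_injective.injOn).image natGenerator with hSst_def
  set E : Finset ℕ := S₀ ∪ Sst ∪ c.natAbs.primeFactors with hE_def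
  have hinf := PlusDescent.infinite_kolyvaginPrime_localization_fullOrder_pair (W.conductorNorm ℤ) W hcm hΔ K hK hns hρ σ hσ
    L hL1 X Y (m := 2) (κ := 2) (by norm_num) (by norm_num) hXord hYord hsK (Or.inl rfl) hτX hτY hres
  obtain ⟨ℓ', hℓ'mem, hℓ'E⟩ := hinf.exists_notMem_finset E
  obtain ⟨hFrobL, hKol', hidxL, hloc'⟩ := hℓ'mem
  have hℓ'p : ℓ'.Prime := hKol'.1
  haveI : Fact ℓ'.Prime := ⟨hℓ'p⟩
  have hidx' : 2 ≤ Zhang2014.kolyvaginIndex W 2 ℓ' := hL2.trans hidxL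
  have hFrob4' : FrobEqFrobInfty W K (2 ^ 2) ℓ' := hFrobL.of_dvd (pow_dvd_pow 2 hL2)
  have hℓ'S₀ : ℓ' ∉ S₀ := fun h ↦ hℓ'E (by simp [hE_def, h])
  have hℓ'Sst : ℓ' ∉ Sst := fun h ↦ hℓ'E (by simp [hE_def, h])
  have hℓ'c : ¬ ((ℓ' : ℤ) ∣ c) := by
    intro h
    apply hℓ'E
    have : ℓ' ∈ c.natAbs.primeFactors :=
      Nat.mem_primeFactors.mpr ⟨hℓ'p, Int.natCast_dvd.mp h, Int.natAbs_ne_zero.mpr hc0⟩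
    simp [hE_def, this]
  -- the place `v′` of `ℚ` and the inert place `w′` of `K`
  set v' : HeightOneSpectrum (𝓞 ℚ) := primesEquiv.symm ⟨ℓ', hℓ'p⟩ with hv'_def
  have hℓ'v' : (ℓ' : 𝓞 ℚ) ∈ v'.asIdeal := natCast_mem_primesEquiv_symm hℓ'p
  have hv'out : (Sum.inr v' : Place ℚ) ∉ s ∪ t := by
    intro h
    apply hℓ'Sst
    rw [hSst_def, Finset.mem_image]
    exact ⟨v', Finset.mem_preimage.mpr h, natGenerator_eq_of_natCast_prime_mem hℓ'p hℓ'v'⟩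
  obtain ⟨w', hℓ'w'⟩ := exists_natCast_mem (K := K) hℓ'p
  haveI hw'v' : w'.asIdeal.LiesOver v'.asIdeal := liesOver_of_natCast_mem hℓ'p hℓ'v' hℓ'w'
  have hf' : w'.asIdeal.inertiaDeg (𝓞 ℚ) = 2 :=
    inertiaDeg_eq_two_of_span_isPrime h2K hℓ'p hKol'.2.2.2.2.1 hℓ'v' hℓ'w'
  have hℓ'2 : ℓ' ≠ 2 := hKol'.2.2.2.1
  have hgood' : W.HasGoodReductionAtPrime ℓ' := hasGoodReductionAtPrime_of_not_dvd_conductorNorm W hKol'.2.1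
  have hcv' : ((c : ℤ) : 𝓞 ℚ) ∉ v'.asIdeal := intCast_notMem_of_not_dvd hℓ'p hℓ'v' hℓ'c
  obtain ⟨hOrdX, hOrdY⟩ := hloc' w' hℓ'w'
  -- ### the level-`2^L` order clauses give the level-`4` order clauses
  have hdesc : ∀ (u : galH1Torsion (W.baseChange K) ((2 ^ 2 : ℕ) : ℤ)), addOrderOf u = 2 ^ 2 →
      (∀ j : ℕ, ((2 ^ j : ℕ) : ℤ) • ι u ∈ (W.baseChange K).torsionLocalKer (w'.adicCompletion K) ((2 ^ L : ℕ) : ℤ) ↔ 2 ≤ j) →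
      ∀ j : ℕ, ((2 ^ j : ℕ) : ℤ) • u ∈ (W.baseChange K).torsionLocalKer (w'.adicCompletion K) ((2 ^ 2 : ℕ) : ℤ) ↔ 2 ≤ j := by
    intro u hu hU j
    refine ⟨fun h ↦ (hU j).mp ?_, fun hj ↦ ?_⟩
    · rw [← map_zsmul]
      exact torsionH1OfDvd_mem_torsionLocalKer (W.baseChange K) (w'.adicCompletion K) h4L h
    · have h0 : ((2 ^ j : ℕ) : ℤ) • u = 0 := by
        rw [natCast_zsmul, ← addOrderOf_dvd_iff_nsmul_eq_zero, hu]
        exact pow_dvd_pow 2 hj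
      rw [h0]
      exact AddSubgroup.zero_mem _
  have hOrdZ := hdesc cK hcK4 hOrdX
  have hOrdYK := hdesc yK hyKord hOrdY
  -- ### the bookkeeping at `ℓ′`
  obtain ⟨Z, cK', hZ, hKum, hRel, hfree, htr⟩ :=
    hS₀ ℓ' v' w' hw'v' hℓ'S₀ hℓ'p hℓ'v' hℓ'w' hKol' hFrobL hidxL hv'out hOrdZ hOrdYK
  exact ⟨v', ℓ', ⟨hℓ'p⟩, w', hw'v', Z, cK, cK', hv'out, hℓ'2, hℓ'v', hgood', hcv', hFrob4', hidx', hf', hZ, hKum, hRel, hOrdZ,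
    hOrdYK, hfree, htr⟩

end Summit.BirchSwinnertonDyer.BirchSwinnertonDyer.Theorems.GenusExact.RelaxedCount

end
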